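import Summits.NavierStokesRegularity.FluidComputer.PalasekTowerSpeedLimit
import Summits.NavierStokesRegularity.FluidComputer.PalasekTowerSpeedMaximum

/-!
# REGISTER v2.3′: the sup-norm COMPARISON PRINCIPLE — the speed maximum of a classical flow is dominated by
# the time integral of the projected push at its running maxima (crossing of a general moving level)

Cell `ns-blowup`, seat `ns-blowup-fc-prover-3` (g3; prover; D-0074 GROUP C/E «BRIDGE SUPPORT»;
bears_on LADDER-NS N1, route `PalasekTowerBreakdown`, cruxes stmt-NavierStokesRegularity-19249 / -19250
(upper stubs `AprioriCeilingAt k` / `AprioriCeiling`) — supports only, nothing claimed). Generalises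
`PalasekTowerLineCrossing.lean` (p446722: lines) and `PalasekTowerSpeedLimit.lean` (p447684: constant rate
bound) to a GENERAL `C¹` moving level and a TIME-DEPENDENT rate bound. LABEL: E–C typing (KERNEL analysis;
every statement PROVED; no `Prop` or definition introduced). WHAT THIS IS NOT: not Navier–Stokes evidence
— an a-priori comparison inequality every finite-energy classical Clay flow satisfies; nothing constructed,
no stub decided.

## What is proved

* `exists_levelCrossing_of_clayContinuation` — first crossing of a general continuous moving level `ℓ`,
  bounded below by `L₁ > 0`, `> ‖u‖` on `[0, T₁]`, reached at `T₂`, with a left derivative `ℓ'(t)` at every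
  `t ∈ (T₁, T₂]`: at the first crossing `(t⋆, x⋆)` (a global argmax) `ℓ'(t⋆) ‖u‖ ≤ ⟪u, ∂ₜu⟫` and
  `ν|Du|²_F + ⟪u, ∇p⟫ + ℓ'(t⋆) ‖u‖ ≤ ⟪u, f⟫`.
* `norm_le_add_integral_of_pushRate` — THE COMPARISON PRINCIPLE: if `‖u‖ ≤ A` on `[0, T₁] × ℝ³` and at
  every later running global speed maximum above `A` (exceeding all earlier speeds) the projected push
  obeys `⟪u, f⟫ − ⟪u, ∇p⟫ ≤ k(t) ‖u‖` for a continuous `k ≥ 0`, then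
  `‖u(t, x)‖ ≤ A + ∫_{T₁}^{t} k(s) ds` on `[T₁, T] × ℝ³` (moving level `A + ε + ∫ (k + η)`, FTC, `ε, η ↓ 0`).
  The constant case `k ≡ K` is p447684's `norm_le_of_pushRate`.
* `Stage.continuation_norm_le_add_integral` — the register's form for a finite-energy classical
  continuation of a level-`k` stage (`k ≥ 1`, quiet): `‖u(t, ·)‖ ≤ c₂ Y_k + ∫_{τ_k}^{t} P` whenever
  `‖∇p(s, x)‖ ≤ P(s)` at running maxima above `c₂ Y_k` — so NO OVERSHOOT of `c₂ Y_{k+1}` before `τ_{k+1}`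
  as long as `∫_{τ_k}^{τ_{k+1}} P < c₂ (Y_{k+1} − Y_k)` (`Stage.continuation_norm_le_ceiling_of_integral_lt`):
  the upper stub as a bound on the pressure-gradient IMPULSE at running speed maxima.

* (append) INTEGRAL FORMS of the hand-over signatures: `Stage.jump_le_integral_gradPressure_quiet` (the
  pressure-gradient IMPULSE at running speed maxima over a silent window is at least the jump
  `c₁ Y_{j+1} − c₂ Y_j`) and `Stage.firstJump_le_integral_gradPressure` (first window: at least the jump
  `c₁ Y₁ − c₁ Y₀` minus the force impulse `c₄ Y₀ (τ₁ − τ₀)`; under `Pins Λ₀`: `≥ (1 − Λ₀⁻¹)` of the jump).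

References: D. Gilbarg, N. Trudinger, *Elliptic PDE of second order*, §3.1 [cite: GilbargTrudinger2001, §3.1];
S. Palasek, arXiv:2605.13827 §4 [cite: Palasek2026ElementaryModel, §4].
-/

noncomputable section

namespace Summit.NavierStokesRegularity.FluidComputer.PalasekTowerClayBridge

open Set MeasureTheory Filter Topology Function Real intervalIntegral
open scoped ENNReal ContDiff NNReal InnerProductSpace RealInnerProductSpace Interval
open Laplacian
open Literature.Analysis.FluidPDE

/-! ## §1 First crossing of a general moving level -/

/-- **FIRST CROSSING OF A MOVING LEVEL by the speed maximum of ANY finite-energy classical Clay flow**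
(`ν > 0`). Let `ℓ` be continuous on `[0, T₂]`, `ℓ ≥ L₁ > 0` there, `‖u‖ < L₁` on `[0, T₁] × ℝ³`
(`0 ≤ T₁ ≤ T₂ ≤ T`), `ℓ(T₂)` reached at `T₂`, and let `ℓ` have a left derivative `ℓ'(t)` at every
`t ∈ (T₁, T₂]`. Then `ℓ` is first crossed at some `t⋆ ∈ (T₁, T₂]`, at a global argmax `x⋆`:
`‖u(t⋆, x⋆)‖ = ℓ(t⋆)`, `‖u‖ < ℓ` on `[0, t⋆) × ℝ³`, `ℓ'(t⋆) ‖u‖ ≤ ⟪u, ∂ₜu⟫`, and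
`ν|Du|²_F + ⟪u, ∇p⟫ + ℓ'(t⋆) ‖u‖ ≤ ⟪u, f⟫`. [cite: GilbargTrudinger2001, §3.1] -/
theorem exists_levelCrossing_of_clayContinuation {ν T : ℝ} (hν : 0 < ν) (hT : 0 < T)
    {f u : ℝ → EuclideanSpace ℝ (Fin 3) → EuclideanSpace ℝ (Fin 3)}
    {p : ℝ → EuclideanSpace ℝ (Fin 3) → ℝ}
    (h : IsClassicalNSSolutionOn (Icc 0 T) ν f u p) (h₀ : HasRapidSpatialDecay (u 0))
    (hfs : IsSmoothOnHalfSpace f) (hfd : HasRapidSpaceTimeDecay f)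
    (hE : ∃ C : ℝ≥0∞, C < ⊤ ∧ ∀ t ∈ Icc 0 T, ∫⁻ x, ‖u t x‖ₑ ^ 2 ≤ C)
    {ℓ ℓ' : ℝ → ℝ} {L₁ T₁ T₂ : ℝ} (hT₁ : 0 ≤ T₁) (hT₁₂ : T₁ ≤ T₂) (hT₂ : T₂ ≤ T)
    (hℓc : ContinuousOn ℓ (Icc 0 T₂)) (hL₁ : 0 < L₁) (hℓL : ∀ t ∈ Icc 0 T₂, L₁ ≤ ℓ t)
    (hderiv : ∀ t ∈ Ioc T₁ T₂, HasDerivWithinAt ℓ (ℓ' t) (Iic t) t)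
    (hbefore : ∀ t ∈ Icc 0 T₁, ∀ x, ‖u t x‖ < L₁) (hreach : ∃ x, ℓ T₂ ≤ ‖u T₂ x‖) :
    ∃ t₀ ∈ Ioc T₁ T₂, ∃ x₀ : EuclideanSpace ℝ (Fin 3),
      ‖u t₀ x₀‖ = ℓ t₀ ∧ (∀ x, ‖u t₀ x‖ ≤ ‖u t₀ x₀‖) ∧ (∀ t ∈ Ico 0 t₀, ∀ x, ‖u t x‖ < ℓ t) ∧
      ℓ' t₀ * ‖u t₀ x₀‖ ≤ ⟪u t₀ x₀, timeDerivWithin (Icc 0 T) u t₀ x₀⟫ ∧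
      ν * frobeniusNormSq (fderiv ℝ (u t₀) x₀) + ⟪u t₀ x₀, gradient (p t₀) x₀⟫ + ℓ' t₀ * ‖u t₀ x₀‖ ≤
        ⟪u t₀ x₀, f t₀ x₀⟫ := by
  obtain ⟨-, hdec⟩ := exists_bound_and_radius_of_clay hν hT h h₀ hfs hfd hE
  obtain ⟨ρ, hρ⟩ := hdec L₁ hL₁
  have hdec' : ∃ ρ : ℝ, ∀ t ∈ Icc 0 T₂, ∀ x : EuclideanSpace ℝ (Fin 3), ρ ≤ ‖x‖ → ‖u t x‖ < ℓ t :=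
    ⟨ρ, fun t ht x hx => lt_of_lt_of_le (hρ t ⟨ht.1, ht.2.trans hT₂⟩ x hx) (hℓL t ht)⟩
  have hbefore' : ∀ t ∈ Icc 0 T₁, ∀ x, ‖u t x‖ < ℓ t := fun t ht x =>
    lt_of_lt_of_le (hbefore t ht x) (hℓL t ⟨ht.1, ht.2.trans hT₁₂⟩)
  obtain ⟨t₀, ht₀, x₀, heq, hle, hstrict⟩ :=
    HittingCalculus.exists_firstHitting_movingLevel_of_decay h hℓc ⟨hT₁, hT₁₂.trans hT₂⟩ hT₁₂ hT₂
      hbefore' hreach hdec'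
  have ht₀' : t₀ ∈ Ioc 0 T := ⟨lt_of_le_of_lt hT₁ ht₀.1, ht₀.2.trans hT₂⟩
  have hmax : ∀ x, ‖u t₀ x‖ ≤ ‖u t₀ x₀‖ := fun x => (hle x).trans heq.ge
  have hpast : ∀ t ∈ Ico 0 t₀, ‖u t x₀‖ ≤ ℓ t := fun t ht => (hstrict t ht x₀).le
  have htime := HittingCalculus.inner_timeDeriv_ge_of_past_le h ht₀' (hderiv t₀ ht₀) hpast heq
  have hineq := HittingCalculus.hitting_inequality_drift h hν.le ht₀' hmax (hderiv t₀ ht₀) hpast heq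
  rw [mul_comm (ℓ t₀) (ℓ' t₀), ← heq] at htime hineq
  exact ⟨t₀, ht₀, x₀, heq, hmax, hstrict, htime, hineq⟩

/-! ## §2 The comparison principle -/

/-- **THE SUP-NORM COMPARISON PRINCIPLE.** Let `(u, p)` be a finite-energy classical solution on `[0, T]`
with Schwartz datum and Clay force (`ν > 0`), `‖u‖ ≤ A` on `[0, T₁] × ℝ³` (`0 ≤ T₁ ≤ T`), and let
`k : ℝ → ℝ` be continuous with `k ≥ 0`. If at every `t ∈ (T₁, T]` and every global argmax `x` of
`‖u(t, ·)‖` with `A < ‖u(t, x)‖` exceeding all earlier speeds the projected push obeys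
`⟪u, f⟫ − ⟪u, ∇p⟫ ≤ k(t) ‖u‖`, then `‖u(t, x)‖ ≤ A + ∫_{T₁}^{t} k` for all `t ∈ [T₁, T]` and all `x`.
(First crossing of the level `A + ε + ∫_{T₁} (k + η)`: there `(k + η)‖u‖ ≤ ⟪u, f⟫ − ⟪u, ∇p⟫ − ν|Du|²_F
≤ k‖u‖` with `‖u‖ > 0` — absurd; then `ε, η ↓ 0`.) [cite: GilbargTrudinger2001, §3.1] -/
theorem norm_le_add_integral_of_pushRate {ν T : ℝ} (hν : 0 < ν) (hT : 0 < T)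
    {f u : ℝ → EuclideanSpace ℝ (Fin 3) → EuclideanSpace ℝ (Fin 3)}
    {p : ℝ → EuclideanSpace ℝ (Fin 3) → ℝ}
    (h : IsClassicalNSSolutionOn (Icc 0 T) ν f u p) (h₀ : HasRapidSpatialDecay (u 0))
    (hfs : IsSmoothOnHalfSpace f) (hfd : HasRapidSpaceTimeDecay f)
    (hE : ∃ C : ℝ≥0∞, C < ⊤ ∧ ∀ t ∈ Icc 0 T, ∫⁻ x, ‖u t x‖ₑ ^ 2 ≤ C)
    {A T₁ : ℝ} (hT₁ : T₁ ∈ Icc 0 T) {k : ℝ → ℝ} (hk : Continuous k) (hk0 : ∀ t, 0 ≤ k t)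
    (hA : ∀ t ∈ Icc 0 T₁, ∀ x, ‖u t x‖ ≤ A)
    (hpush : ∀ t ∈ Ioc T₁ T, ∀ x : EuclideanSpace ℝ (Fin 3),
      (∀ y, ‖u t y‖ ≤ ‖u t x‖) → A < ‖u t x‖ → (∀ t' ∈ Ico 0 t, ∀ y, ‖u t' y‖ < ‖u t x‖) →
      ⟪u t x, f t x⟫ - ⟪u t x, gradient (p t) x⟫ ≤ k t * ‖u t x‖) :
    ∀ t ∈ Icc T₁ T, ∀ x, ‖u t x‖ ≤ A + ∫ s in T₁..t, k s := by
  intro t ht x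
  have hA0 : 0 ≤ A := (norm_nonneg _).trans (hA 0 ⟨le_rfl, hT₁.1⟩ 0)
  -- it suffices to beat `A + ε + ∫ (k + η)` for all small `ε, η > 0`
  by_contra hgt
  have hgt' : A + ∫ s in T₁..t, k s < ‖u t x‖ := lt_of_not_ge hgt
  have hT₁t : T₁ < t := by
    rcases ht.1.eq_or_lt with h' | h'
    · exfalso
      rw [← h', intervalIntegral.integral_same, add_zero] at hgt'
      exact absurd (hA T₁ ⟨hT₁.1, le_rfl⟩ x) (not_le.2 hgt')
    · exact h'
  set gap : ℝ := ‖u t x‖ - (A + ∫ s in T₁..t, k s) with hgapdef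
  have hgap : 0 < gap := by simp only [hgapdef]; linarith
  set ε : ℝ := gap / 3 with hεdef
  have hε : 0 < ε := by positivity
  set η : ℝ := gap / (3 * (t - T₁)) with hηdef
  have hη : 0 < η := by simp only [hηdef]; exact div_pos hgap (by nlinarith)
  have hw0 : t - T₁ ≠ 0 := (sub_pos.2 hT₁t).ne'
  have hηw : η * (t - T₁) = gap / 3 := by
    rw [hηdef, div_mul_eq_mul_div, mul_div_mul_right _ _ hw0]
  -- the moving level `ℓ(s) = A + ε + ∫_{T₁}^{max s T₁} (k + η)` and its left derivative `k(s) + η`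
  set g : ℝ → ℝ := fun s => k s + η with hgdef
  have hgc : Continuous g := hk.add continuous_const
  have hg0 : ∀ s, 0 ≤ g s := fun s => add_nonneg (hk0 s) hη.le
  set F : ℝ → ℝ := fun s => ∫ r in T₁..s, g r with hFdef
  have hFc : Continuous F := intervalIntegral.continuous_primitive (fun a b => hgc.intervalIntegrable a b) T₁
  have hFd : ∀ s, HasDerivAt F (g s) s := fun s => (hgc.integral_hasStrictDerivAt T₁ s).hasDerivAt
  set ℓ : ℝ → ℝ := fun s => A + ε + F (max s T₁) with hℓdef
  have hℓc : Continuous ℓ := continuous_const.add (hFc.comp (continuous_id.max continuous_const))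
  have hF0 : ∀ s, T₁ ≤ s → 0 ≤ F s := fun s hs =>
    intervalIntegral.integral_nonneg hs fun r _ => hg0 r
  have hℓL : ∀ s ∈ Icc 0 t, A + ε ≤ ℓ s := fun s _ => by
    simp only [hℓdef]; linarith [hF0 (max s T₁) (le_max_right _ _)]
  have hderiv : ∀ s ∈ Ioc T₁ t, HasDerivWithinAt ℓ (g s) (Iic s) s := by
    intro s hs
    have h1 : HasDerivAt (fun r => A + ε + F r) (g s) s := (hFd s).const_add (A + ε)
    refine (h1.congr_of_eventuallyEq ?_).hasDerivWithinAt
    filter_upwards [Ioi_mem_nhds hs.1] with r hr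
    simp only [hℓdef]; rw [max_eq_left (le_of_lt hr)]
  have hbefore : ∀ s ∈ Icc 0 T₁, ∀ y, ‖u s y‖ < A + ε := fun s hs y =>
    lt_of_le_of_lt (hA s hs y) (by linarith)
  -- the level is reached at `t`: `ℓ t = A + ε + ∫ k + η (t − T₁) = A + ∫ k + 2 gap/3 < ‖u t x‖`
  have hℓt : ℓ t = A + ε + (∫ s in T₁..t, k s) + η * (t - T₁) := by
    simp only [hℓdef, hFdef, hgdef]
    rw [max_eq_left ht.1, intervalIntegral.integral_add (hk.intervalIntegrable _ _)
      (continuous_const.intervalIntegrable _ _), intervalIntegral.integral_const, smul_eq_mul]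
    ring
  have hreach : ∃ y, ℓ t ≤ ‖u t y‖ := ⟨x, by rw [hℓt, hηw]; simp only [hεdef, hgapdef]; linarith⟩
  obtain ⟨t₀, ht₀, x₀, hval, hmax, hstrict, -, hineq⟩ :=
    exists_levelCrossing_of_clayContinuation hν hT h h₀ hfs hfd hE hT₁.1 ht.1 ht.2
      hℓc.continuousOn (by linarith) hℓL hderiv hbefore hreach
  have ht₀' : t₀ ∈ Ioc T₁ T := ⟨ht₀.1, ht₀.2.trans ht.2⟩
  have hlow : A < ‖u t₀ x₀‖ := by
    rw [hval]; linarith [hℓL t₀ ⟨hT₁.1.trans ht₀.1.le, ht₀.2⟩]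
  have hpos : 0 < ‖u t₀ x₀‖ := lt_of_le_of_lt hA0 hlow
  -- `ℓ` is nondecreasing, so the crossing point exceeds all earlier speeds
  have hmono : ∀ s, s ≤ t₀ → ℓ s ≤ ℓ t₀ := by
    intro s hs
    simp only [hℓdef]
    have hm : max s T₁ ≤ max t₀ T₁ := max_le_max hs le_rfl
    have hsub : F (max t₀ T₁) - F (max s T₁) = ∫ r in (max s T₁)..(max t₀ T₁), g r := by
      simp only [hFdef]
      rw [intervalIntegral.integral_interval_sub_left (hgc.intervalIntegrable _ _)
        (hgc.intervalIntegrable _ _)]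
    have hnn : 0 ≤ ∫ r in (max s T₁)..(max t₀ T₁), g r :=
      intervalIntegral.integral_nonneg hm fun r _ => hg0 r
    linarith
  have hstrict' : ∀ t' ∈ Ico 0 t₀, ∀ y, ‖u t' y‖ < ‖u t₀ x₀‖ := fun t' ht' y =>
    lt_of_lt_of_le (hstrict t' ht' y) (by rw [hval]; exact hmono t' ht'.2.le)
  have hp := hpush t₀ ht₀' x₀ hmax hlow hstrict'
  have hF : 0 ≤ ν * frobeniusNormSq (fderiv ℝ (u t₀) x₀) := mul_nonneg hν.le (frobeniusNormSq_nonneg _)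
  have h1 : g t₀ * ‖u t₀ x₀‖ ≤ k t₀ * ‖u t₀ x₀‖ := by linarith
  have h2 : g t₀ * ‖u t₀ x₀‖ = k t₀ * ‖u t₀ x₀‖ + η * ‖u t₀ x₀‖ := by simp only [hgdef]; ring
  have h3 : 0 < η * ‖u t₀ x₀‖ := mul_pos hη hpos
  linarith

/-! ## §3 Continuations of registered stages: no overshoot from a bound on the pressure-gradient impulse -/

namespace Stage

variable {ν : ℝ} {R : TowerRates} {S : Schedule R} {m : Margins R} {k : ℕ}

/-- **The comparison principle for a continuation of a registered stage** (`ν > 0`, quiet schedule,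
`k ≥ 1`): if `‖∇p(t, x)‖ ≤ P(t)` (`P` continuous, `≥ 0`) at every running global speed maximum above
`c₂ Y_k` after `τ_k` of a finite-energy classical continuation `(u, p)` on `[0, T']`, then
`‖u(t, x)‖ ≤ c₂ Y_k + ∫_{τ_k}^{t} P` on `[τ_k, T'] × ℝ³` (force silent). [cite: Palasek2026ElementaryModel, §4] -/
theorem continuation_norm_le_add_integral (hν : 0 < ν) (hQ : S.Quiet) (hk : 1 ≤ k)
    (s : Stage ν R S m k) {T' : ℝ} (hT' : S.τ k ≤ T')
    {u : ℝ → EuclideanSpace ℝ (Fin 3) → EuclideanSpace ℝ (Fin 3)}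
    {p : ℝ → EuclideanSpace ℝ (Fin 3) → ℝ}
    (hcl : IsClassicalNSSolutionOn (Icc 0 T') ν S.f u p)
    (hagree : ∀ t ∈ Icc 0 (S.τ k), u t = s.u t)
    (henergy : ∃ C : ℝ≥0∞, C < ⊤ ∧ ∀ t ∈ Icc 0 T', ∫⁻ x, ‖u t x‖ₑ ^ 2 ≤ C)
    {P : ℝ → ℝ} (hPc : Continuous P) (hP0 : ∀ t, 0 ≤ P t)
    (hbd : ∀ t ∈ Ioc (S.τ k) T', ∀ x : EuclideanSpace ℝ (Fin 3),
      (∀ y, ‖u t y‖ ≤ ‖u t x‖) → S.c₂ * R.Y k < ‖u t x‖ →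
      (∀ t' ∈ Ico 0 t, ∀ y, ‖u t' y‖ < ‖u t x‖) → ‖gradient (p t) x‖ ≤ P t) :
    ∀ t ∈ Icc (S.τ k) T', ∀ x, ‖u t x‖ ≤ S.c₂ * R.Y k + ∫ s in (S.τ k)..t, P s := by
  have hT'0 : 0 < T' := (S.τ_pos k).trans_le hT'
  have h₀ : HasRapidSpatialDecay (u 0) := by
    rw [hagree 0 ⟨le_rfl, (S.τ_pos k).le⟩]
    exact s.hasRapidSpatialDecay_zero
  have hA : ∀ t ∈ Icc 0 (S.τ k), ∀ x, ‖u t x‖ ≤ S.c₂ * R.Y k := fun t ht x => by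
    rw [hagree t ht]; exact s.ceiling k le_rfl t ht x
  refine norm_le_add_integral_of_pushRate hν hT'0 hcl h₀ S.force_smooth S.force_decay henergy
    ⟨(S.τ_pos k).le, hT'⟩ hPc hP0 hA ?_
  intro t ht x hmax hlow hstrict
  have h1 : S.τ 1 ≤ t := (S.τ_mono hk).trans ht.1.le
  rw [hQ.apply h1 x, inner_zero_right, zero_sub]
  have hCS : - ⟪u t x, gradient (p t) x⟫ ≤ ‖u t x‖ * ‖gradient (p t) x‖ := by
    have := abs_real_inner_le_norm (u t x) (gradient (p t) x)
    have := neg_abs_le ⟪u t x, gradient (p t) x⟫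
    linarith
  have h2 : ‖u t x‖ * ‖gradient (p t) x‖ ≤ ‖u t x‖ * P t :=
    mul_le_mul_of_nonneg_left (hbd t ht x hmax hlow hstrict) (norm_nonneg _)
  linarith

/-- **NO OVERSHOOT FROM A BOUND ON THE PRESSURE-GRADIENT IMPULSE** (`ν > 0`, quiet, `k ≥ 1`,
`T' ∈ [τ_k, τ_{k+1}]`): if `‖∇p‖ ≤ P(t)` at running global speed maxima above `c₂ Y_k` of the continuation
and the impulse over the window is small, `∫_{τ_k}^{τ_{k+1}} P ≤ c₂ (Y_{k+1} − Y_k)`, then the continuation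
stays inside the next ceiling: `‖u‖ ≤ c₂ Y_{k+1}` on `[0, T'] × ℝ³`. The upper stub `AprioriCeilingAt k`
asks this of EVERY continuation of EVERY registered level-`k` stage. [cite: Palasek2026ElementaryModel, §4] -/
theorem continuation_norm_le_ceiling_of_integral_le (hν : 0 < ν) (hQ : S.Quiet) (hk : 1 ≤ k)
    (s : Stage ν R S m k) {T' : ℝ} (hT' : T' ∈ Icc (S.τ k) (S.τ (k + 1)))
    {u : ℝ → EuclideanSpace ℝ (Fin 3) → EuclideanSpace ℝ (Fin 3)}
    {p : ℝ → EuclideanSpace ℝ (Fin 3) → ℝ}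
    (hcl : IsClassicalNSSolutionOn (Icc 0 T') ν S.f u p)
    (hagree : ∀ t ∈ Icc 0 (S.τ k), u t = s.u t)
    (henergy : ∃ C : ℝ≥0∞, C < ⊤ ∧ ∀ t ∈ Icc 0 T', ∫⁻ x, ‖u t x‖ₑ ^ 2 ≤ C)
    {P : ℝ → ℝ} (hPc : Continuous P) (hP0 : ∀ t, 0 ≤ P t)
    (hbd : ∀ t ∈ Ioc (S.τ k) T', ∀ x : EuclideanSpace ℝ (Fin 3),
      (∀ y, ‖u t y‖ ≤ ‖u t x‖) → S.c₂ * R.Y k < ‖u t x‖ →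
      (∀ t' ∈ Ico 0 t, ∀ y, ‖u t' y‖ < ‖u t x‖) → ‖gradient (p t) x‖ ≤ P t)
    (himp : ∫ s in (S.τ k)..(S.τ (k + 1)), P s ≤ S.c₂ * R.Y (k + 1) - S.c₂ * R.Y k) :
    ∀ t ∈ Icc 0 T', ∀ x, ‖u t x‖ ≤ S.c₂ * R.Y (k + 1) := by
  intro t ht x
  have hc₂ : 0 < S.c₂ := s.c₂_pos
  have hAB : S.c₂ * R.Y k ≤ S.c₂ * R.Y (k + 1) :=
    mul_le_mul_of_nonneg_left (R.Y_lt_Y_succ k).le hc₂.le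
  rcases le_or_gt t (S.τ k) with htk | htk
  · rw [hagree t ⟨ht.1, htk⟩]
    exact (s.ceiling k le_rfl t ⟨ht.1, htk⟩ x).trans hAB
  · have hmain := s.continuation_norm_le_add_integral hν hQ hk hT'.1 hcl hagree henergy hPc hP0 hbd
      t ⟨htk.le, ht.2⟩ x
    -- the impulse up to `t ≤ T' ≤ τ_{k+1}` is at most the window impulse
    have hmono : ∫ s in (S.τ k)..t, P s ≤ ∫ s in (S.τ k)..(S.τ (k + 1)), P s := by
      have hsub : (∫ s in (S.τ k)..(S.τ (k + 1)), P s) - ∫ s in (S.τ k)..t, P s =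
          ∫ s in t..(S.τ (k + 1)), P s := by
        rw [intervalIntegral.integral_interval_sub_left (hPc.intervalIntegrable _ _)
          (hPc.intervalIntegrable _ _)]
      have hnn : 0 ≤ ∫ s in t..(S.τ (k + 1)), P s :=
        intervalIntegral.integral_nonneg (ht.2.trans hT'.2) fun r _ => hP0 r
      linarith
    linarith

/-- **THE PRESSURE IMPULSE OF A SILENT HAND-OVER IS AT LEAST THE JUMP** (`ν > 0`, quiet schedule,
`1 ≤ j`, `j + 1 ≤ k`): if `‖∇p(t, x)‖ ≤ P(t)` (`P` continuous, `≥ 0`) at every running global speed maximum of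
a registered stage above `c₂ Y_j` in `(τ_j, τ_{j+1}]` (exceeding all earlier speeds), then
`c₁ Y_{j+1} − c₂ Y_j ≤ ∫_{τ_j}^{τ_{j+1}} P` — the comparison principle on the sub-slab `[0, τ_{j+1}]` against
the floor at `τ_{j+1}`. The integral form of `Stage.exists_window_pressureRate_quiet` (p446972); at `j = 1`
on rigid wide schedules the jump is `Y₂ − (5/3) Y₁ ∈ (1507, 1510)`. [cite: Palasek2026ElementaryModel, §4] -/
theorem jump_le_integral_gradPressure_quiet (hν : 0 < ν) (hQ : S.Quiet) (s : Stage ν R S m k) {j : ℕ}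
    (hj1 : 1 ≤ j) (hj : j + 1 ≤ k) {P : ℝ → ℝ} (hPc : Continuous P) (hP0 : ∀ t, 0 ≤ P t)
    (hbd : ∀ t ∈ Ioc (S.τ j) (S.τ (j + 1)), ∀ x : EuclideanSpace ℝ (Fin 3),
      (∀ y, ‖s.u t y‖ ≤ ‖s.u t x‖) → S.c₂ * R.Y j < ‖s.u t x‖ →
      (∀ t' ∈ Ico 0 t, ∀ y, ‖s.u t' y‖ < ‖s.u t x‖) → ‖gradient (s.p t) x‖ ≤ P t) :
    S.c₁ * R.Y (j + 1) - S.c₂ * R.Y j ≤ ∫ t in (S.τ j)..(S.τ (j + 1)), P t := by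
  -- the stage restricted to the sub-slab `[0, τ_{j+1}]`
  have hτ0 : 0 < S.τ (j + 1) := S.τ_pos _
  have hsub : Icc 0 (S.τ (j + 1)) ⊆ Icc 0 (S.τ k) := Icc_subset_Icc_right (S.τ_mono hj)
  have hcl : IsClassicalNSSolutionOn (Icc 0 (S.τ (j + 1))) ν S.f s.u s.p :=
    s.classical.mono hsub (uniqueDiffOn_Icc hτ0)
  have henergy : ∃ C : ℝ≥0∞, C < ⊤ ∧ ∀ t ∈ Icc 0 (S.τ (j + 1)), ∫⁻ x, ‖s.u t x‖ₑ ^ 2 ≤ C := by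
    obtain ⟨C, hC, hb⟩ := s.energy
    exact ⟨C, hC, fun t ht => hb t (hsub ht)⟩
  have hA : ∀ t ∈ Icc 0 (S.τ j), ∀ x, ‖s.u t x‖ ≤ S.c₂ * R.Y j := fun t ht x =>
    s.ceiling j ((Nat.le_succ j).trans hj) t ht x
  have hmain := norm_le_add_integral_of_pushRate hν hτ0 hcl s.hasRapidSpatialDecay_zero S.force_smooth
    S.force_decay henergy (T₁ := S.τ j) ⟨(S.τ_pos j).le, (S.τ_lt_succ j).le⟩ hPc hP0 hA ?_
  · obtain ⟨x, -, hx⟩ := s.floor (j + 1) hj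
    have h1 := hmain (S.τ (j + 1)) ⟨(S.τ_lt_succ j).le, le_rfl⟩ x
    linarith
  · intro t ht x hmax hlow hstrict
    have h1 : S.τ 1 ≤ t := (S.τ_mono hj1).trans ht.1.le
    rw [hQ.apply h1 x, inner_zero_right, zero_sub]
    have hCS : - ⟪s.u t x, gradient (s.p t) x⟫ ≤ ‖s.u t x‖ * ‖gradient (s.p t) x‖ := by
      linarith [abs_real_inner_le_norm (s.u t x) (gradient (s.p t) x),
        neg_abs_le ⟪s.u t x, gradient (s.p t) x⟫]
    have h2 : ‖s.u t x‖ * ‖gradient (s.p t) x‖ ≤ ‖s.u t x‖ * P t :=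
      mul_le_mul_of_nonneg_left (hbd t ht x hmax hlow hstrict) (norm_nonneg _)
    linarith

/-- **THE PRESSURE IMPULSE OF THE FIRST EPISODE** (`ν > 0`, `1 ≤ k`, global anchor): if `‖∇p(t, x)‖ ≤ P(t)`
at every running global speed maximum above `c₁ Y₀` in the forced window `(τ₀, τ₁]`, then
`c₁ Y₁ − c₁ Y₀ − c₄ Y₀ (τ₁ − τ₀) ≤ ∫_{τ₀}^{τ₁} P` (the force contributes at most its impulse `c₄ Y₀ (τ₁ − τ₀)`;
comparison principle with `k = P + c₄ Y₀` from the anchor value `c₁ Y₀`); under `Pins Λ₀ θ` (`Λ₀ > 0`) the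
pressure impulse is at least `(1 − Λ₀⁻¹)(c₁ Y₁ − c₁ Y₀)` — on the wide rates with `Pins 8`: `≥ (7/8)(Y₁ − Y₀)
> 1247`. The integral form of `Stage.exists_firstWindow_pressureRate`. [cite: Palasek2026ElementaryModel, §3.3] -/
theorem firstJump_le_integral_gradPressure (hν : 0 < ν) (s : Stage ν R S (Margins.routeG R) k) (hk : 1 ≤ k)
    {P : ℝ → ℝ} (hPc : Continuous P) (hP0 : ∀ t, 0 ≤ P t)
    (hbd : ∀ t ∈ Ioc (S.τ 0) (S.τ 1), ∀ x : EuclideanSpace ℝ (Fin 3),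
      (∀ y, ‖s.u t y‖ ≤ ‖s.u t x‖) → S.c₁ * R.Y 0 < ‖s.u t x‖ →
      (∀ t' ∈ Ico 0 t, ∀ y, ‖s.u t' y‖ < ‖s.u t x‖) → ‖gradient (s.p t) x‖ ≤ P t) :
    S.c₁ * R.Y 1 - S.c₁ * R.Y 0 - S.c₄ * R.Y 0 * (S.τ 1 - S.τ 0) ≤ ∫ t in (S.τ 0)..(S.τ 1), P t ∧
      ∀ {Λ₀ θ : ℝ}, S.Pins Λ₀ θ → 0 < Λ₀ →
        (1 - Λ₀⁻¹) * (S.c₁ * R.Y 1 - S.c₁ * R.Y 0) ≤ ∫ t in (S.τ 0)..(S.τ 1), P t := by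
  have hτ0 : 0 < S.τ 1 := S.τ_pos _
  have hY0 : 0 < R.Y 0 := Real.rpow_pos_of_pos (R.N_pos 0) _
  have hc₄ : 0 ≤ S.c₄ := S.c₄_nonneg
  have hsub : Icc 0 (S.τ 1) ⊆ Icc 0 (S.τ k) := Icc_subset_Icc_right (S.τ_mono hk)
  have hcl : IsClassicalNSSolutionOn (Icc 0 (S.τ 1)) ν S.f s.u s.p :=
    s.classical.mono hsub (uniqueDiffOn_Icc hτ0)
  have henergy : ∃ C : ℝ≥0∞, C < ⊤ ∧ ∀ t ∈ Icc 0 (S.τ 1), ∫⁻ x, ‖s.u t x‖ₑ ^ 2 ≤ C := by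
    obtain ⟨C, hC, hb⟩ := s.energy
    exact ⟨C, hC, fun t ht => hb t (hsub ht)⟩
  have hA : ∀ t ∈ Icc 0 (S.τ 0), ∀ x, ‖s.u t x‖ ≤ S.c₁ * R.Y 0 := by
    intro t ht x
    rcases ht.2.eq_or_lt with h' | h'
    · rw [h']; exact s.norm_τ_zero_le x
    · exact (s.routeG_anchorGlobal t ⟨ht.1, h'⟩ x).le
  have hkc : Continuous fun t => P t + S.c₄ * R.Y 0 := hPc.add continuous_const
  have hk0 : ∀ t, 0 ≤ P t + S.c₄ * R.Y 0 := fun t => add_nonneg (hP0 t) (mul_nonneg hc₄ hY0.le)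
  have hmain := norm_le_add_integral_of_pushRate hν hτ0 hcl s.hasRapidSpatialDecay_zero S.force_smooth
    S.force_decay henergy (T₁ := S.τ 0) ⟨(S.τ_pos 0).le, (S.τ_lt_succ 0).le⟩ hkc hk0 hA ?_
  · obtain ⟨x, -, hx⟩ := s.floor 1 hk
    have h1 := hmain (S.τ 1) ⟨(S.τ_lt_succ 0).le, le_rfl⟩ x
    rw [intervalIntegral.integral_add (hPc.intervalIntegrable _ _) (continuous_const.intervalIntegrable _ _),
      intervalIntegral.integral_const, smul_eq_mul] at h1
    have hfirst : S.c₁ * R.Y 1 - S.c₁ * R.Y 0 - S.c₄ * R.Y 0 * (S.τ 1 - S.τ 0) ≤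
        ∫ t in (S.τ 0)..(S.τ 1), P t := by linarith
    refine ⟨hfirst, fun {Λ₀ θ} hP hΛ₀ => ?_⟩
    have himp := hP.impulse 0
    rw [zero_add] at himp
    have hc₁₂ : S.c₁ * R.Y 0 ≤ S.c₂ * R.Y 0 := mul_le_mul_of_nonneg_right s.c₁_le_c₂ hY0.le
    have hbudget : S.c₄ * R.Y 0 * (S.τ 1 - S.τ 0) ≤ Λ₀⁻¹ * (S.c₁ * R.Y 1 - S.c₁ * R.Y 0) := by
      rw [le_inv_mul_iff₀' hΛ₀]
      have e : Λ₀ * (S.c₄ * R.Y 0) * (S.τ 1 - S.τ 0) = (S.c₄ * R.Y 0 * (S.τ 1 - S.τ 0)) * Λ₀ := by ring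
      linarith
    have e2 : (1 - Λ₀⁻¹) * (S.c₁ * R.Y 1 - S.c₁ * R.Y 0) =
        (S.c₁ * R.Y 1 - S.c₁ * R.Y 0) - Λ₀⁻¹ * (S.c₁ * R.Y 1 - S.c₁ * R.Y 0) := by ring
    linarith
  · intro t ht x hmax hlow hstrict
    have hCS : - ⟪s.u t x, gradient (s.p t) x⟫ ≤ ‖s.u t x‖ * ‖gradient (s.p t) x‖ := by
      linarith [abs_real_inner_le_norm (s.u t x) (gradient (s.p t) x),
        neg_abs_le ⟪s.u t x, gradient (s.p t) x⟫]
    have hf : ⟪s.u t x, S.f t x⟫ ≤ ‖s.u t x‖ * (S.c₄ * R.Y 0) :=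
      s.inner_force_le_of_window (j := 0) ⟨ht.1.le, ht.2⟩ x
    have h2 : ‖s.u t x‖ * ‖gradient (s.p t) x‖ ≤ ‖s.u t x‖ * P t :=
      mul_le_mul_of_nonneg_left (hbd t ht x hmax hlow hstrict) (norm_nonneg _)
    nlinarith [norm_nonneg (s.u t x)]

end Stage

end Summit.NavierStokesRegularity.FluidComputer.PalasekTowerClayBridge

end
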